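import Mathlib.FieldTheory.KummerExtension
import Mathlib.Analysis.SpecialFunctions.Pow.Deriv
import Literature.Topology.FourManifolds.LefschetzBaseArcs
import Literature.Topology.FourManifolds.LefschetzBaseCover
import HarnessLib

/-!
# The Joukowski branch of the vanishing cycle over the symmetric chord `[ζ_{2g}, ζ_0]`
(wave 4, brick Y4-2a of the model chain (R2) `exists_charted_chain` for the missing lemma
`crossingNumber_eq_stdSymp` of node N1a of stub `stub_modelsOnFibred_of_reach` = NF4, line
`modp-braid-orbits`, crux `ConvexBisection.AcyclicBisectionExists`, item stmt-SmoothPoincare4-10508;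
registered sub-goal `helper_jY_sq`)

The central page `y² = f(x) = x^{2g+1} + 1` is the double cover of the `x`-plane branched at the
roots `ζ_k = e^{iπ(2k+1)/(2g+1)}` (`branchPt`).  Over the SYMMETRIC chord `[ζ_{2g}, ζ_0] = [η̄, η]`,
`η = e^{iπ/(2g+1)} = m + iσ` (`m = cos`, `σ = sin` of `branchAngle g 0`), the vanishing cycle and a
whole annular neighbourhood of it in the page are uniformised by ONE holomorphic injective map of
the `t`-plane (Joukowski):

* `jX g t = m + iσ (t + t⁻¹)/2` — confocal ellipses around the chord (`|t| = 1` is the chord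
  itself, twice), with `(jX − η)(jX − η̄) = −σ² ((t − t⁻¹)/2)²`;
* `bS g x = √(x + 1) · ∏_{k < g−1} √(qfac g k x)`, `qfac g k x = x² − 2 cos θ_{k+1} x + 1 =
  (x − ζ_{k+1})(x − ζ̄_{k+1})` — an explicit square root of `f(x) / ((x − η)(x − η̄))` by principal
  roots of conjugate-paired factors, HOLOMORPHIC on the half-plane `Re x > cos θ_1` (every radicand
  is in the slit plane there, `qfac_mem_slitPlane`) and REAL POSITIVE on the real axis (`bS_ofReal`);
* `jY g t = iσ (t − t⁻¹)/2 · bS (jX t)`, with **`jY² = jX^{2g+1} + 1`** (`jY_sq`, registered as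
  `helper_jY_sq`) by the factorisation `x^{2g+1} + 1 = ∏ (x − ζ_k)` (`pow_add_one_eq_prod`, Kummer)
  regrouped into `(x² − 2mx + 1)(x + 1) ∏ qfac` (`pow_add_one_factor`).

Values used downstream: on the imaginary axis `jX (iρ) = m − σ(ρ − ρ⁻¹)/2 ∈ ℝ`,
`jY (iρ) = −σ(ρ + ρ⁻¹)/2 · bS < 0` (the LOWER sheet, no sign ambiguity), and `jX t⁻¹ = jX t`,
`jY t⁻¹ = −jY t` (the sheet involution), `jX s = jX t ↔ s = t ∨ s = t⁻¹`.
Everything is proved; no `sorry`.  References: J. Milnor, *Singular points of complex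
hypersurfaces* (1968), §9 [Milnor1968]; V. I. Arnold, S. M. Gusein-Zade, A. N. Varchenko,
*Singularities of Differentiable Maps II* (1988), §2 [AGZV1988].
-/

noncomputable section

set_option linter.dupNamespace false

open scoped Manifold ContDiff Topology ComplexConjugate Real
open Set Function Metric Complex Polynomial
open Literature.Topology.FourManifolds Literature.Topology.FourManifolds.LefschetzBase
  Literature.Topology.FourManifolds.TorusKnotMilnor

namespace Summit.SmoothPoincare4.SmoothPoincare4.Theorems.AcyclicBisectionExists.ModpBraidOrbits

variable {g : ℕ}

/-! ## §1 The factorisation of `x^{2g+1} + 1` over the branch points -/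

/-- `x^{2g+1} + 1 = ∏_{k < 2g+1} (x − ζ_k)` (Kummer: `X^n − C a = ∏ (X − C (μ^i α))` with
`α = e^{iπ/n}`, `α^n = −1`, and `ζ_k = α μ^k`). [folklore] -/
theorem pow_add_one_eq_prod (g : ℕ) (x : ℂ) :
    x ^ (2 * g + 1) + 1 = ∏ k ∈ Finset.range (2 * g + 1), (x - branchPt g k) := by
  have hn : 2 * g + 1 ≠ 0 := Nat.succ_ne_zero _
  have h := X_pow_sub_C_eq_prod (isPrimitiveRoot_rootU hn) (Nat.pos_of_ne_zero hn)
    (halfRoot_pow hn)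
  have he := congrArg (Polynomial.eval x) h
  rw [eval_sub, eval_pow, eval_X, eval_C, sub_neg_eq_add, eval_prod] at he
  rw [he]
  refine Finset.prod_congr rfl fun k _ => ?_
  rw [eval_sub, eval_X, eval_C, branchPt_eq_halfRoot_mul, mul_comm]

/-- `ζ_{2g−k} = conj ζ_k` for `k ≤ 2g`. [folklore] -/
theorem branchPt_two_mul_sub {k : ℕ} (hk : k ≤ 2 * g) :
    branchPt g (2 * g - k) = conj (branchPt g k) := by
  have hang : branchAngle g (2 * g - k) = 2 * π - branchAngle g k := by
    unfold branchAngle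
    have h0 : (2 * (g : ℝ) + 1) ≠ 0 := by positivity
    rw [Nat.cast_sub hk]
    push_cast
    field_simp
    ring
  have hconj : conj (branchPt g k) = Complex.exp (((-branchAngle g k : ℝ) : ℂ) * I) := by
    rw [branchPt, ← Complex.exp_conj, map_mul, Complex.conj_ofReal, Complex.conj_I]
    push_cast
    ring_nf
  rw [hconj, branchPt, hang, show ((2 * π - branchAngle g k : ℝ) : ℂ) * I =
    ((-branchAngle g k : ℝ) : ℂ) * I + 2 * π * I by push_cast; ring, Complex.exp_add,
    Complex.exp_two_pi_mul_I, mul_one]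

/-- `ζ_g = −1`. [folklore] -/
theorem branchPt_mid (g : ℕ) : branchPt g g = -1 := by
  rw [branchPt]
  have : branchAngle g g = π := by
    unfold branchAngle
    have h0 : (2 * (g : ℝ) + 1) ≠ 0 := by positivity
    field_simp
  rw [this, Complex.exp_pi_mul_I]

/-- `(x − e^{iθ})(x − e^{−iθ}) = x² − 2 cos θ · x + 1`. [folklore] -/
theorem sub_mul_sub_conj (θ : ℝ) (x : ℂ) :
    (x - Complex.exp (θ * I)) * (x - conj (Complex.exp (θ * I))) =
      x ^ 2 - 2 * (Real.cos θ : ℂ) * x + 1 := by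
  have h1 : Complex.exp (θ * I) + conj (Complex.exp (θ * I)) = 2 * (Real.cos θ : ℂ) := by
    rw [← Complex.exp_conj, map_mul, Complex.conj_ofReal, Complex.conj_I, mul_neg,
      Complex.ofReal_cos, Complex.cos, neg_mul]
    ring
  have h2 : Complex.exp (θ * I) * conj (Complex.exp (θ * I)) = 1 := by
    rw [Complex.mul_conj, Complex.normSq_eq_norm_sq, Complex.norm_exp_ofReal_mul_I]; norm_num
  linear_combination (-x) * h1 + h2

/-- The conjugate-paired quadratic factors `qfac g k x = x² − 2 cos θ_{k+1} · x + 1 =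
(x − ζ_{k+1})(x − ζ̄_{k+1})`, `θ_{k+1} = branchAngle g (k+1)`. [folklore] -/
def qfac (g k : ℕ) (x : ℂ) : ℂ := x ^ 2 - 2 * (Real.cos (branchAngle g (k + 1)) : ℂ) * x + 1

/-- `qfac g k x = (x − ζ_{k+1})(x − ζ_{2g−1−k})` for `k + 1 ≤ 2g`. [folklore] -/
theorem qfac_eq {k : ℕ} (hk : k + 1 ≤ 2 * g) (x : ℂ) :
    qfac g k x = (x - branchPt g (k + 1)) * (x - branchPt g (2 * g - 1 - k)) := by
  rw [show 2 * g - 1 - k = 2 * g - (k + 1) by omega, branchPt_two_mul_sub hk, branchPt,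
    sub_mul_sub_conj, qfac]

/-- The middle of the chord: `m = cos (π/(2g+1)) = Re η`. [folklore] -/
def cmid (g : ℕ) : ℝ := Real.cos (branchAngle g 0)

/-- The half-length of the chord: `σ = sin (π/(2g+1)) = Im η`. [folklore] -/
def shalf (g : ℕ) : ℝ := Real.sin (branchAngle g 0)

/-- `0 < π/(2g+1) < π` for `g ≥ 1`, hence `σ > 0`. [folklore] -/
theorem shalf_pos (hg : 1 ≤ g) : 0 < shalf g := by
  unfold shalf branchAngle
  have h0 : (0 : ℝ) < 2 * g + 1 := by positivity
  have hg' : (1 : ℝ) ≤ g := by exact_mod_cast hg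
  refine Real.sin_pos_of_pos_of_lt_pi (by positivity) ?_
  rw [div_lt_iff₀ h0]
  push_cast
  nlinarith [Real.pi_pos]

/-- `m² + σ² = 1`. [folklore] -/
theorem cmid_sq_add_shalf_sq (g : ℕ) : cmid g ^ 2 + shalf g ^ 2 = 1 := by
  rw [cmid, shalf, Real.cos_sq_add_sin_sq]

/-- **The regrouped factorisation** `x^{2g+1} + 1 = (x² − 2mx + 1) · ((x + 1) ∏_{k<g−1} qfac g k x)`
(`g ≥ 1`; the roots are `η, η̄`, `−1`, and the conjugate pairs `ζ_{k+1}, ζ_{2g−1−k}`). [folklore] -/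
theorem pow_add_one_factor (hg : 1 ≤ g) (x : ℂ) :
    x ^ (2 * g + 1) + 1 = (x ^ 2 - 2 * (cmid g : ℂ) * x + 1) *
      ((x + 1) * ∏ k ∈ Finset.range (g - 1), qfac g k x) := by
  set F : ℕ → ℂ := fun k => x - branchPt g k with hF
  rw [pow_add_one_eq_prod]
  -- regroup `range (2g+1) = range g ∪ {g} ∪ (g+1 + range g)`
  have e1 : ∏ k ∈ Finset.range (2 * g + 1), F k =
      (∏ k ∈ Finset.range g, F k) * ((∏ j ∈ Finset.range g, F (g + (j + 1))) * F (g + 0)) := by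
    rw [show 2 * g + 1 = g + (g + 1) by ring, Finset.prod_range_add, Finset.prod_range_succ']
  have e2 : ∏ k ∈ Finset.range g, F k = (∏ k ∈ Finset.range (g - 1), F (k + 1)) * F 0 := by
    conv_lhs => rw [show g = (g - 1) + 1 by omega]
    rw [Finset.prod_range_succ']
  have e3 : ∏ j ∈ Finset.range g, F (g + (j + 1)) =
      (∏ k ∈ Finset.range (g - 1), F (2 * g - 1 - k)) * F (2 * g) := by
    rw [← Finset.prod_range_reflect (fun j => F (g + (j + 1))) g]
    conv_lhs => rw [show g = (g - 1) + 1 by omega]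
    rw [Finset.prod_range_succ']
    congr 1
    · refine Finset.prod_congr rfl fun k hk => ?_
      rw [Finset.mem_range] at hk
      congr 1; omega
    · congr 1; omega
  rw [e1, e2, e3]
  have epair : ∀ k ∈ Finset.range (g - 1), F (k + 1) * F (2 * g - 1 - k) = qfac g k x := by
    intro k hk
    rw [Finset.mem_range] at hk
    rw [hF, qfac_eq (by omega)]
  have e4 : (∏ k ∈ Finset.range (g - 1), F (k + 1)) * ∏ k ∈ Finset.range (g - 1), F (2 * g - 1 - k) =
      ∏ k ∈ Finset.range (g - 1), qfac g k x := by
    rw [← Finset.prod_mul_distrib]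
    exact Finset.prod_congr rfl epair
  have e5 : F 0 * F (2 * g) = x ^ 2 - 2 * (cmid g : ℂ) * x + 1 := by
    rw [hF]; dsimp only
    rw [show 2 * g = 2 * g - 0 from rfl, branchPt_two_mul_sub (Nat.zero_le _), branchPt,
      sub_mul_sub_conj, cmid]
  have e6 : F (g + 0) = x + 1 := by rw [hF]; dsimp only; rw [add_zero, branchPt_mid, sub_neg_eq_add]
  rw [e6, ← e5, ← e4]
  ring

/-! ## §2 The branch `bS`, the Joukowski coordinate `jX` and the sheet `jY` -/

/-- **The explicit square root** `bS g x = √(x + 1) ∏_{k<g−1} √(qfac g k x)` of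
`f(x)/((x − η)(x − η̄))` (principal roots factor by factor). [cite: Milnor1968, §9] -/
def bS (g : ℕ) (x : ℂ) : ℂ := csqrt (x + 1) * ∏ k ∈ Finset.range (g - 1), csqrt (qfac g k x)

/-- `bS² = (x + 1) ∏ qfac`. [folklore] -/
theorem bS_sq (g : ℕ) (x : ℂ) : bS g x ^ 2 = (x + 1) * ∏ k ∈ Finset.range (g - 1), qfac g k x := by
  rw [bS, mul_pow, csqrt_sq, ← Finset.prod_pow]
  congr 1
  exact Finset.prod_congr rfl fun k _ => csqrt_sq _

/-- **The Joukowski coordinate** `jX g t = m + iσ (t + t⁻¹)/2`: the circles `|t| = ρ` go to the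
confocal ellipses with foci `η̄, η`, the unit circle to the chord (twice). [folklore] -/
def jX (g : ℕ) (t : ℂ) : ℂ := (cmid g : ℂ) + (shalf g : ℂ) * I * ((t + t⁻¹) / 2)

/-- **The sheet** `jY g t = iσ (t − t⁻¹)/2 · bS (jX t)`. [cite: Milnor1968, §9] -/
def jY (g : ℕ) (t : ℂ) : ℂ := (shalf g : ℂ) * I * ((t - t⁻¹) / 2) * bS g (jX g t)

/-- The sheet involution on `jX`: `jX t⁻¹ = jX t`. [folklore] -/
theorem jX_inv (g : ℕ) (t : ℂ) : jX g t⁻¹ = jX g t := by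
  rw [jX, jX, inv_inv, add_comm t⁻¹ t]

/-- The sheet involution on `jY`: `jY t⁻¹ = −jY t`. [folklore] -/
theorem jY_inv (g : ℕ) (t : ℂ) : jY g t⁻¹ = -jY g t := by
  rw [jY, jY, jX_inv, inv_inv]; ring

/-- `(jX − η)(jX − η̄) = jX² − 2m jX + 1 = (iσ (t − t⁻¹)/2)²`. [folklore] -/
theorem jX_sq_sub (g : ℕ) {t : ℂ} (ht : t ≠ 0) :
    jX g t ^ 2 - 2 * (cmid g : ℂ) * jX g t + 1 = ((shalf g : ℂ) * I * ((t - t⁻¹) / 2)) ^ 2 := by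
  have h1 : ((cmid g : ℂ)) ^ 2 + (shalf g : ℂ) ^ 2 = 1 := by exact_mod_cast cmid_sq_add_shalf_sq g
  have h2 : t * t⁻¹ = 1 := mul_inv_cancel₀ ht
  rw [jX]
  linear_combination (-1 : ℂ) * h1 - (shalf g : ℂ) ^ 2 * h2 +
    (shalf g : ℂ) ^ 2 * t * t⁻¹ * Complex.I_sq

/-- **`jY² = jX^{2g+1} + 1`**: the Joukowski map lands on the central page (`g ≥ 1`, `t ≠ 0`).
[cite: Milnor1968, §9] -/
theorem jY_sq (hg : 1 ≤ g) {t : ℂ} (ht : t ≠ 0) : jY g t ^ 2 = jX g t ^ (2 * g + 1) + 1 := by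
  rw [pow_add_one_factor hg, jX_sq_sub g ht, ← bS_sq, jY]
  ring

/-- **Joukowski injectivity**: `jX s = jX t ↔ s = t ∨ s = t⁻¹` (`g ≥ 1`, `s, t ≠ 0`). [folklore] -/
theorem jX_eq_jX_iff (hg : 1 ≤ g) {s t : ℂ} (hs : s ≠ 0) (ht : t ≠ 0) :
    jX g s = jX g t ↔ s = t ∨ s = t⁻¹ := by
  constructor
  · intro h
    have hσ : (shalf g : ℂ) * I ≠ 0 := mul_ne_zero (by exact_mod_cast (shalf_pos hg).ne') I_ne_zero
    have h1 : s + s⁻¹ = t + t⁻¹ := by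
      have h' := h
      rw [jX, jX, add_right_inj] at h'
      linear_combination 2 * mul_left_cancel₀ hσ h'
    have h2 : (s - t) * (s * t - 1) = 0 := by
      field_simp at h1
      linear_combination h1
    rcases mul_eq_zero.1 h2 with h3 | h3
    · exact Or.inl (sub_eq_zero.1 h3)
    · right
      rw [sub_eq_zero] at h3
      exact eq_inv_of_mul_eq_one_left h3
  · rintro (rfl | rfl)
    · rfl
    · exact jX_inv g t

/-! ## §3 Holomorphy of the branch on the half-plane `Re x > cos θ_1` -/

/-- Real and imaginary parts of `x² − 2cx + 1` (`c² + s² = 1`):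
`((Re x − c)² − (Im x)² + s², 2 Im x (Re x − c))`. [folklore] -/
theorem quad_re_im (x : ℂ) {c s : ℝ} (hcs : c ^ 2 + s ^ 2 = 1) :
    x ^ 2 - 2 * (c : ℂ) * x + 1 =
      ⟨(x.re - c) ^ 2 - x.im ^ 2 + s ^ 2, 2 * x.im * (x.re - c)⟩ := by
  apply Complex.ext
  · simp [sq, Complex.mul_re]; nlinarith
  · simp [sq, Complex.mul_im]; ring

/-- `x² − 2 cos θ x + 1 = (x − cos θ)² + sin² θ` is in the slit plane as soon as `Re x > cos θ`.
[folklore] -/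
theorem quad_mem_slitPlane {θ : ℝ} {x : ℂ} (hx : Real.cos θ < x.re) :
    x ^ 2 - 2 * (Real.cos θ : ℂ) * x + 1 ∈ slitPlane := by
  rw [quad_re_im x (Real.cos_sq_add_sin_sq θ), Complex.mem_slitPlane_iff]
  dsimp only
  by_cases h0 : x.im = 0
  · left; rw [h0]; nlinarith [sq_nonneg (Real.sin θ), sq_pos_of_pos (sub_pos.2 hx)]
  · right; exact mul_ne_zero (mul_ne_zero two_ne_zero h0) (sub_ne_zero.2 hx.ne')

/-- `cos θ_{k+1} ≤ cos θ_1` for the factors that occur (`k < g − 1`). [folklore] -/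
theorem cos_branchAngle_succ_le {k : ℕ} (hk : k < g - 1) :
    Real.cos (branchAngle g (k + 1)) ≤ Real.cos (branchAngle g 1) := by
  have h0 : (0 : ℝ) < 2 * g + 1 := by positivity
  have hk' : (k : ℝ) + 2 ≤ g := by exact_mod_cast (show k + 2 ≤ g by omega)
  refine Real.cos_le_cos_of_nonneg_of_le_pi ?_ ?_ ?_
  · unfold branchAngle; positivity
  · unfold branchAngle
    rw [div_le_iff₀ h0]
    push_cast
    nlinarith [Real.pi_pos]
  · unfold branchAngle
    apply div_le_div_of_nonneg_right _ h0.le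
    have hk0 : (0 : ℝ) ≤ k := Nat.cast_nonneg k
    push_cast
    nlinarith [Real.pi_pos]

/-- Every radicand of `bS` is in the slit plane when `Re x > cos θ_1`. [folklore] -/
theorem qfac_mem_slitPlane {k : ℕ} (hk : k < g - 1) {x : ℂ} (hx : Real.cos (branchAngle g 1) < x.re) :
    qfac g k x ∈ slitPlane :=
  quad_mem_slitPlane ((cos_branchAngle_succ_le hk).trans_lt hx)

/-- `cos θ_1 ≥ −1`, so `x + 1` is in the slit plane when `Re x > cos θ_1`. [folklore] -/
theorem add_one_mem_slitPlane {x : ℂ} (hx : Real.cos (branchAngle g 1) < x.re) : x + 1 ∈ slitPlane := by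
  rw [Complex.mem_slitPlane_iff]; left
  rw [Complex.add_re, Complex.one_re]
  linarith [Real.neg_one_le_cos (branchAngle g 1)]

/-- **`bS` is holomorphic on `Re x > cos θ_1`.** [folklore] -/
theorem differentiableAt_bS {x : ℂ} (hx : Real.cos (branchAngle g 1) < x.re) :
    DifferentiableAt ℂ (bS g) x := by
  unfold bS csqrt
  refine ((differentiableAt_id.add_const 1).cpow_const (add_one_mem_slitPlane hx)).mul ?_
  have : (fun y => ∏ k ∈ Finset.range (g - 1), qfac g k y ^ (2 : ℂ)⁻¹) =
      ∏ k ∈ Finset.range (g - 1), fun y => qfac g k y ^ (2 : ℂ)⁻¹ := by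
    funext y; simp [Finset.prod_apply]
  rw [this]
  refine DifferentiableAt.finsetProd fun k hk => ?_
  rw [Finset.mem_range] at hk
  have hq : DifferentiableAt ℂ (qfac g k) x := by unfold qfac; fun_prop
  exact hq.cpow_const (qfac_mem_slitPlane hk hx)

/-- `bS` is continuous at every point of `Re x > cos θ_1`. [folklore] -/
theorem continuousAt_bS {x : ℂ} (hx : Real.cos (branchAngle g 1) < x.re) : ContinuousAt (bS g) x :=
  (differentiableAt_bS hx).continuousAt

/-- `cos θ_1 < m` for `g ≥ 1` (`θ_0 < θ_1 ≤ π`). [folklore] -/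
theorem cos_branchAngle_one_lt_cmid (hg : 1 ≤ g) : Real.cos (branchAngle g 1) < cmid g := by
  have h0 : (0 : ℝ) < 2 * g + 1 := by positivity
  have hg' : (1 : ℝ) ≤ g := by exact_mod_cast hg
  unfold cmid
  refine Real.cos_lt_cos_of_nonneg_of_le_pi (by unfold branchAngle; positivity) ?_ ?_
  · unfold branchAngle
    rw [div_le_iff₀ h0]
    push_cast
    nlinarith [Real.pi_pos]
  · unfold branchAngle
    apply div_lt_div_of_pos_right _ h0
    push_cast
    nlinarith [Real.pi_pos]

/-! ## §4 Real values: the branch is positive on the real axis, the imaginary `t`-axis is the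
## lower sheet over the perpendicular bisector of the chord -/

/-- `√r` of a non-negative real, as a complex number, is the real square root. [folklore] -/
theorem csqrt_ofReal {r : ℝ} (hr : 0 ≤ r) : csqrt (r : ℂ) = (Real.sqrt r : ℂ) := by
  rw [csqrt, Real.sqrt_eq_rpow, Complex.ofReal_cpow hr]
  norm_num

/-- The radicands are positive on the real axis: `ξ² − 2 cos θ ξ + 1 = (ξ − cos θ)² + sin² θ > 0`
unless `ξ = cos θ`, `sin θ = 0`; we use it for `ξ > cos θ`. [folklore] -/
theorem quad_pos {θ ξ : ℝ} (h : Real.cos θ < ξ) : 0 < ξ ^ 2 - 2 * Real.cos θ * ξ + 1 := by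
  nlinarith [Real.cos_sq_add_sin_sq θ, sq_nonneg (Real.sin θ), sq_pos_of_pos (sub_pos.2 h)]

/-- **On the real axis (to the right of `cos θ_1`) the branch is a positive real number.**
[folklore] -/
theorem bS_ofReal {ξ : ℝ} (hξ : Real.cos (branchAngle g 1) < ξ) :
    ∃ r : ℝ, 0 < r ∧ bS g ξ = r := by
  refine ⟨Real.sqrt (ξ + 1) * ∏ k ∈ Finset.range (g - 1),
    Real.sqrt (ξ ^ 2 - 2 * Real.cos (branchAngle g (k + 1)) * ξ + 1), ?_, ?_⟩
  · refine mul_pos (Real.sqrt_pos.2 (by linarith [Real.neg_one_le_cos (branchAngle g 1)])) ?_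
    refine Finset.prod_pos fun k hk => Real.sqrt_pos.2 (quad_pos ?_)
    rw [Finset.mem_range] at hk
    exact (cos_branchAngle_succ_le hk).trans_lt hξ
  · rw [bS, Complex.ofReal_mul, Complex.ofReal_prod]
    congr 1
    · rw [← csqrt_ofReal (by linarith [Real.neg_one_le_cos (branchAngle g 1)])]; push_cast; rfl
    · refine Finset.prod_congr rfl fun k hk => ?_
      rw [Finset.mem_range] at hk
      rw [← csqrt_ofReal (quad_pos ((cos_branchAngle_succ_le hk).trans_lt hξ)).le, qfac]
      push_cast; rfl

/-- `jX` on the imaginary axis: `jX (iρ) = m − σ (ρ − ρ⁻¹)/2` is REAL. [folklore] -/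
theorem jX_I_mul (g : ℕ) (ρ : ℝ) :
    jX g (I * ρ) = ((cmid g - shalf g * ((ρ - ρ⁻¹) / 2) : ℝ) : ℂ) := by
  rw [jX, mul_inv, Complex.inv_I]
  push_cast
  linear_combination ((shalf g : ℂ) * (((ρ : ℂ) - (ρ : ℂ)⁻¹) / 2)) * Complex.I_sq

/-- `jY` on the imaginary axis: `jY (iρ) = −σ (ρ + ρ⁻¹)/2 · bS (jX (iρ))` — a NEGATIVE multiple
of the (positive) branch: the imaginary axis of the `t`-plane is the lower sheet over the
perpendicular bisector of the chord. [folklore] -/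
theorem jY_I_mul (g : ℕ) (ρ : ℝ) :
    jY g (I * ρ) = -((shalf g * ((ρ + ρ⁻¹) / 2) : ℝ) : ℂ) * bS g (jX g (I * ρ)) := by
  rw [jY]
  congr 1
  rw [mul_inv, Complex.inv_I]
  push_cast
  linear_combination ((shalf g : ℂ) * (((ρ : ℂ) + (ρ : ℂ)⁻¹) / 2)) * Complex.I_sq

/-! ## §5 The registered form -/

/-- **Sub-goal `helper_jY_sq`** (Y4-2a of the model chain (R2) for node N1a of NF4): the Joukowski
branch lands on the central page, `jY² = jX^{2g+1} + 1` for `g ≥ 1`, `t ≠ 0`. [cite: Milnor1968, §9] -/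
theorem helper_jY_sq : ∀ (g : ℕ) (t : ℂ), 1 ≤ g → t ≠ 0 → Summit.SmoothPoincare4.SmoothPoincare4.Theorems.AcyclicBisectionExists.ModpBraidOrbits.jY g t ^ 2 = Summit.SmoothPoincare4.SmoothPoincare4.Theorems.AcyclicBisectionExists.ModpBraidOrbits.jX g t ^ (2 * g + 1) + 1 :=
  fun _ _ hg ht => jY_sq hg ht

end Summit.SmoothPoincare4.SmoothPoincare4.Theorems.AcyclicBisectionExists.ModpBraidOrbits

end
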